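import Summits.BirchSwinnertonDyer.BirchSwinnertonDyer.Theorems.ManinLocalTwoThreeManinOddAtFourCdtThm1
import Summits.BirchSwinnertonDyer.BirchSwinnertonDyer.Theorems.ManinLocalTwoThreeManinPrimeToThreeAtNineCdtThm1
import Summits.BirchSwinnertonDyer.BirchSwinnertonDyer.Theorems.ManinLocalTwoThreeManinPrimeToAdditiveFiveLeCdtThm1
import Summits.BirchSwinnertonDyer.BirchSwinnertonDyer.Theorems.ManinLocalTwoThreeStevensNaturalTes75
import Summits.BirchSwinnertonDyer.BirchSwinnertonDyer.Theorems.ManinLocalTwoThreeAssembly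
import HarnessLib

set_option autoImplicit false
-- the sub-problem namespace `Summit.BirchSwinnertonDyer.BirchSwinnertonDyer` duplicates a component by design (D-0017)
set_option linter.dupNamespace false

/-!
# Route ManinLocalTwoThree after the three crux closures: what the tree now derives BY NAME about the
# conjecture leaves `ManinConstantOne` (Manin 1971) and `StevensConstantOne` (Stevens 1989)

With C2 `ManinOddAtFour` (stmt-BirchSwinnertonDyer-22967, `ManinLocalTwoThree.ManinOddAtFour_proof`), C3 `ManinPrimeToThreeAtNine`
(22968, `ManinLocalTwoThree.ManinPrimeToThreeAtNine_proof`) and C5 `ManinPrimeToAdditiveFiveLe` (22969,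
`ManinLocalTwoThree.ManinPrimeToAdditiveFiveLe_proof`) closed by name — each = the cell's conditional closer applied to the in-tree
unbounded-denominators term `calegariDimitrovTang2025_unboundedDenominators_holds` (p826028) — this file records, as named theorems and
nothing more, the compositions that are now available:

* §1 `maninLocalTwoThree_maninConstantOne_of_printedSemistableManinFacts` — the route's own deciding composition: the support
  `PrintedSemistableManinFacts` (Mazur 1978 Cor. 4.1 ∧ Abbes–Ullmo 1996 Thm. A ∧ Česnavičius 2018 Thm. 1.2 ∧ the Modularity Theorem
  `exists_isNewformOf`, cite-only) implies the registered leaf `Rank1Residual.ManinConstant.ManinConstantOne`, through the route's `closes`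
  with the three by-name crux closers and `maninLocalTwoThree_assembly_proof`.
* §2 `maninConstantOne_of_modularity` / `ManinLocalTwoThree.ManinConstantOneRung_of_modularity` — the SHARPER form: the first three
  conjuncts are themselves discharged in the tree (`mazur_not_dvd_maninConstant_of_odd_holds` p828097,
  `abbesUllmo_not_dvd_maninConstant_of_not_dvd_level_holds`, `cesnavicius_not_two_dvd_maninConstant_of_two_dvd_level_holds` p828339), so the
  leaf and the route's rung target `ManinConstantOneRung` (stmt-BirchSwinnertonDyer-22445) follow from the Modularity Theorem ALONE
  (`maninLocalTwoThree_maninConstantOne_of_CDT_of_modularity` / `…Rung_of_CDT_of_modularity`, p767029 lineage, with CDT discharged).  Modularity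
  is genuinely used (level = conductor by strong multiplicity one, `IsNewformOf.level_eq_conductorNorm_of_exists_isNewformOf`, in the
  exclusion of the Frey-twist shape at `2⁵ ∣ N`); it is a cite-only printed theorem, so 22445 stays OPEN as filed (conditional result).
* §3 `stevensConstantOne_proof` — Stevens' conjecture leaf `Rank1Residual.ManinConstant.StevensConstantOne` (`|c₁| = 1` for every optimal
  `X₁(N)`-datum of a globally minimal curve) BY NAME with NO hypothesis: `CDivisionInt.abs_maninConstant₁_eq_one_of_CDTInt` (cell bsd-f2-manin
  p2, the `c₁`-division witness + Wohlfahrt inside `Γ₁(N)`) on the in-tree UDC term.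

DEPENDENCY AND WORDING OF RECORD (director-bsd (849)(2)(4), (853)(1)(2)).  Every theorem here depends on
`calegariDimitrovTang2025_unboundedDenominators_holds` — UDC-DEPENDENT.  Status: PROVED AS TYPED (kernel; axioms `propext`, `Classical.choice`,
`Quot.sound`); typed = meant only as far as the falsifiers F1/F2 and ref1 §R345–§R347 could tell; lean4checker replay and external expert read
PENDING (audit (P†)).  AS-TYPED vs PRINT: §3 (Stevens' conjecture, open in print) and §2 (Manin's conjecture from modularity alone, open in
print) are «⊋ print» BY-PRODUCTS of one in-house formalisation chain and are therefore, by this programme's own prior, FIRST suspects of a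
definitional mismatch (`Gamma1ParametrizationData.IsOptimal`, `ModularParametrizationData`, `periodLattice(Gamma1)`, `maninConstant`, the
vendored CDT statement) and only second discoveries.  THIS FILE IS NOT AN ANNOUNCEMENT: no line of it says that Manin's or Stevens'
conjecture is proved; the wording of record is «the tree derives `StevensConstantOne` AS TYPED, and `ManinConstantOne` AS TYPED from the
Modularity Theorem, from the in-tree UDC term; MEANING UNDER AUDIT (P†) + external expert read pending».  BSD is proved for no curve by this.
[cite: CalegariDimitrovTang2025, Thm. 1.0.1] [cite: Stevens1989, §2] [cite: DiamondShurman2005, Thm. 8.8.3]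
[cite: CesnaviciusNeururerSaha2023, §1 p. 574 with fn. 2]
-/

noncomputable section

open Literature.NumberTheory.EllipticCurves Literature.NumberTheory.EllipticCurves.ModularForms
open Literature.NumberTheory.Automorphic

namespace Summit.BirchSwinnertonDyer.BirchSwinnertonDyer.Theorems

/-! ## §1 The route's deciding composition, by name -/

/-- **`PrintedSemistableManinFacts → ManinConstantOne`, the route's own composition**: the deciding theorem
`Theses.ManinLocalTwoThree.closes` fed with the three BY-NAME crux closers `ManinLocalTwoThree.ManinOddAtFour_proof` (C2, 22967),
`ManinLocalTwoThree.ManinPrimeToThreeAtNine_proof` (C3, 22968), `ManinLocalTwoThree.ManinPrimeToAdditiveFiveLe_proof` (C5, 22969) and the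
assembly `maninLocalTwoThree_assembly_proof` (22450).  The one remaining hypothesis is the cite-only support (three printed Manin-constant
theorems and the Modularity Theorem).  UDC-dependent; audit (P†) pending; not an announcement; BSD is not proved by this.
[cite: CalegariDimitrovTang2025, Thm. 1.0.1] [cite: DiamondShurman2005, Thm. 8.8.3] -/
theorem maninLocalTwoThree_maninConstantOne_of_printedSemistableManinFacts
    (hPF : Summit.BirchSwinnertonDyer.BirchSwinnertonDyer.Theses.ManinLocalTwoThree.PrintedSemistableManinFacts) :
    Summit.BirchSwinnertonDyer.Rank1Residual.ManinConstant.ManinConstantOne :=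
  Summit.BirchSwinnertonDyer.BirchSwinnertonDyer.Theses.ManinLocalTwoThree.closes hPF
    ManinLocalTwoThree.ManinOddAtFour_proof ManinLocalTwoThree.ManinPrimeToThreeAtNine_proof
    ManinLocalTwoThree.ManinPrimeToAdditiveFiveLe_proof maninLocalTwoThree_assembly_proof

/-! ## §2 Manin's conjecture leaf and the rung item from the Modularity Theorem alone -/

/-- **`ManinConstantOne` AS TYPED from the Modularity Theorem alone**: for every globally minimal `W/ℚ` and every lattice-optimal
`X₀(N)`-datum `D` (`Λ_W = c · Λ_f`), `|c| = 1` — GIVEN `exists_isNewformOf` (Wiles / Taylor–Wiles / BCDT; cite-only; used for level = conductor).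
= `maninLocalTwoThree_maninConstantOne_of_CDT_of_modularity` with CDT discharged by the in-tree UDC term.  CONDITIONAL (modularity);
UDC-dependent; «⊋ print» by-product, meaning under audit (P†); NOT an announcement of Manin's conjecture; BSD is not proved by this.
[cite: DiamondShurman2005, Thm. 8.8.3] [cite: CalegariDimitrovTang2025, Thm. 1.0.1] -/
theorem maninConstantOne_of_modularity (hnf : exists_isNewformOf) :
    Summit.BirchSwinnertonDyer.Rank1Residual.ManinConstant.ManinConstantOne :=
  maninLocalTwoThree_maninConstantOne_of_CDT_of_modularity calegariDimitrovTang2025_unboundedDenominators_holds hnf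

/-- **The rung target `ManinConstantOneRung` (stmt-BirchSwinnertonDyer-22445) BY NAME modulo the Modularity Theorem alone**
(`maninLocalTwoThree_maninConstantOneRung_of_CDT_of_modularity` with CDT discharged).  CONDITIONAL (the gate records a conditional result; the
item stays OPEN as filed — its own hypothesis-free signature is not proved); UDC-dependent; audit (P†) pending; not an announcement; BSD is
not proved by this. [cite: DiamondShurman2005, Thm. 8.8.3] [cite: CalegariDimitrovTang2025, Thm. 1.0.1] -/
theorem ManinLocalTwoThree.ManinConstantOneRung_of_modularity (hnf : exists_isNewformOf) :
    Summit.BirchSwinnertonDyer.BirchSwinnertonDyer.Theses.ManinLocalTwoThree.ManinConstantOneRung :=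
  maninLocalTwoThree_maninConstantOneRung_of_CDT_of_modularity calegariDimitrovTang2025_unboundedDenominators_holds hnf

/-! ## §3 Stevens' conjecture leaf, by name -/

/-- **`StevensConstantOne` AS TYPED** (the conjecture leaf of `Summits/BirchSwinnertonDyer/Rank1Residual/ManinConstantOne.lean`): for every
globally minimal `W/ℚ`, every `N ≥ 1` and every `X₁(N)`-datum `D₁ : Gamma1ParametrizationData W N` with the lattice clause `D₁.IsOptimal`
(`Λ_W = c₁ · Λ₁(f)`), `|D₁.maninConstant| = 1` — `CDivisionInt.abs_maninConstant₁_eq_one_of_CDTInt` (the `c₁`-division witness is a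
holomorphic congruence-stabilised form with integer `q`-series; unbounded denominators makes its stabiliser congruence, Wohlfahrt inside
`Γ₁(N)` contradicts optimality when `|c₁| ≥ 2`) on the in-tree UDC term.  NO hypothesis; UDC-DEPENDENT; «⊋ print» (Stevens' conjecture is
OPEN in print: Česnavičius–Neururer–Saha 2024 §1 fn. 2) — hence a by-product whose MEANING IS UNDER AUDIT (P†) (first suspect: the typed
`Gamma1ParametrizationData` / `IsOptimal` / `periodLatticeGamma1` renderings), NOT an announcement of Stevens' conjecture; BSD is not proved
by this. [cite: Stevens1989, §2] [cite: CalegariDimitrovTang2025, Thm. 1.0.1] [cite: CesnaviciusNeururerSaha2023, §1 p. 574 fn. 2] -/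
theorem stevensConstantOne_proof : Summit.BirchSwinnertonDyer.Rank1Residual.ManinConstant.StevensConstantOne :=
  fun _W _ _ _N _ D₁ hopt ↦
    ManinLocalTwoThree.CDivisionInt.abs_maninConstant₁_eq_one_of_CDTInt calegariDimitrovTang2025_unboundedDenominators_holds D₁ hopt

end Summit.BirchSwinnertonDyer.BirchSwinnertonDyer.Theorems

end
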